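import Summits.ResolutionOfSingularities.ResolutionOfSingularities.Theorems.UniversalCellsCampaignW82ExponentZeroProofs
import Summits.ResolutionOfSingularities.ResolutionOfSingularities.Theorems.UniversalCellsCampaignW82KollarCurveAnyFieldAlgebra
import Literature.AlgebraicGeometry.Motives.VarietiesDimensionProofs
import HarnessLib

/-!
# [OURS · L1 W8.2] EXPONENT ZERO IS NOT ENOUGH AT ANY CONSTANT FIELD — `¬ SmoothModelStepRegularAt k 1` for EVERY
# field `k` of characteristic `p` (doors 1 and 2 of slot W8.2)

Cell `res-hironaka`, LADDER-RESOLUTION rung L, slot W8.2; host route `UniversalCells`, host item `PrimeFieldToPerfect`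
(stmt-ResolutionOfSingularities-15233); second door `UniformComplexity.PrimeModelTransfer` (stmt-8933). Proofs file
(Theses-free), written by res-L1-s82-pv-1 (gen 3); the any-field upgrade of
Theorems/UniversalCellsCampaignW82ExponentZeroProofs.lean, whose witness lived over `𝔽_p(t)` only (the barrier
entry's field). Here the constant field `k` is ARBITRARY of characteristic `p` (Kollár 2007, 1.19 is printed for
"`K = k(t)`, where `k` is any field of characteristic `p`"), which is what the slot's second door needs: its
constant fields `M` are algebraically closed (`PerfectionStepAlgClosedDimLe`, `…AlgClosureFgDimLe`), and
`FrobeniusTwistStepRegularAt p M n ↔ PerfectionStepAt M n` holds for every `M` (`residual_normalForms_tfae`).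

WHAT IS PROVED (everything a theorem; no `sorry`, no new axioms):
* §1 the witness over `k(t)` — `KollarCurveAnyField.integralOverPerfectClosure`, `.isIntegral`, `.isRegular`,
  `.ringKrullDim_stalk_le_one`, `.topologicalKrullDim_le_one`, **`.not_hasSmoothProperBirationalModel`** (no proper
  birational `π : Y ⟶ C` with `Y` smooth over `k(t)`; same proof as over `𝔽_p(t)`: `Y` integral, `π` an isomorphism by
  `isIso_of_isBirational_of_isRegular_of_ringKrullDim_le_one`, base change to `k(t)(t^{1/p})` regular — contradiction
  with `KollarCurveAnyField.not_isRegularLocalRing_cuspIdeal`), `.hasSmoothFrobeniusTwistModel` (some twist does).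
* §2 **`not_smoothModelStepRegularAt_one p k : ¬ SmoothModelStepRegularAt k 1`** for every field `k` of characteristic
  `p`; `forall_not_smoothModelStepRegularAt_one`; the juxtaposition with the genuine step
  (`frobeniusTwistStepRegularAt_one_and_not_smoothModelStepRegularAt_one'`); and for every grade `n ≥ 1`:
  `smoothModelStepRegularAt_iff_not_hyp` (pinned step ↔ failure of resolution in dimension `≤ n` over `k(t)`),
  `not_smoothModelStepRegularAt_of_le_three` (⇐ F-02), `smoothModelStepRegularAt_top_iff`,
  `not_smoothModelStepRegularAt_top_of_resolutionInChar`; door 2's pinned shape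
  `not_forall_isAlgClosed_smoothModelStepRegularAt_one` (witness `M = (𝔽_p)^{alg}`).

HONEST FRAMING. OURS campaign theorems about OURS statements (role replaced: §17 ¶2 p.89 l.59–62 of [Hironaka2017],
typed AS PRINTED as `S17Methodology.U89_3`); NOT statements of the manuscript; nothing attributed to its author; no
typed candidate used. Tightness certificates only — the open residual (`PerfectionStepAt M n`, `n ≥ 4`) is untouched.
AI work, weaker than expert review.

## References (locators; nothing cited as a premise)
* J. Kollár, *Lectures on Resolution of Singularities* (2007), 1.19 "Curves over nonperfect fields". [Kollar2007]
* Q. Liu, *Algebraic Geometry and Arithmetic Curves* (2002), Cor. 4.4.3, Ex. 7.3.15, Rem. 4.3.34. [Liu2002]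
* The Stacks Project, Tag 056S. [StacksProject]
* V. Cossart, O. Piltant, J. Algebra 529 (2019), Thm. 1.1 — named fact F-02, hypothesis of one corollary. [CossartPiltant2019]
-/

noncomputable section

set_option linter.dupNamespace false -- mandated namespace of this single-conjunct summit

open _root_.CategoryTheory _root_.CategoryTheory.Limits _root_.AlgebraicGeometry TensorProduct
open Literature.AlgebraicGeometry.Resolution

namespace Summit.ResolutionOfSingularities.ResolutionOfSingularities.Theorems.CampaignW82

universe u

/-! ## §1 The witness over `k(t)`: `C = Spec k(t)[X,Y]/(Y^q − X^p + t)`, `p ∤ q`, `k` ANY field of characteristic `p` -/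

namespace KollarCurveAnyField

variable (k : Type) [Field k] (p : ℕ) [hp : Fact p.Prime] (q : ℕ) [hq : Fact (1 < q)]

omit hp hq in
/-- The structure morphism `C ⟶ Spec k(t)` is locally of finite type (a theorem, not an instance:
use `haveI`). [folklore] -/
theorem locallyOfFiniteType_f₀ :
    LocallyOfFiniteType (Spec.map (CommRingCat.ofHom (algebraMap (RatFunc k) (kollarRing k p q)))) :=
  HasRingHomProperty.Spec_iff.mpr (RingHom.finiteType_algebraMap.mpr inferInstance)

omit hq in
/-- **`C` is integral over the perfect closure** (`IntegralOverPerfectClosure`): over Mathlib's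
`PerfectClosure k(t) p`, in which `t` has a `p`-th root `c`, the base change is
`Spec` of the domain `L ⊗ₖ A` (`KollarCurveAnyField.isDomain_tensor_kollarRing`). [cite: Liu2002, Example 7.3.15 and Remark 4.3.34] -/
theorem integralOverPerfectClosure [CharP k p] (hpq : ¬ p ∣ q) :
    IntegralOverPerfectClosure (RatFunc k)
      (Spec.map (CommRingCat.ofHom (algebraMap (RatFunc k) (kollarRing k p q)))) := by
  let L := PerfectClosure (RatFunc k) p
  letI : Algebra (RatFunc k) L := (PerfectClosure.of (RatFunc k) p).toAlgebra
  haveI : IsPRadical (algebraMap (RatFunc k) L) p :=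
    inferInstanceAs (IsPRadical (PerfectClosure.of (RatFunc k) p) p)
  haveI : IsPurelyInseparable (RatFunc k) L := IsPRadical.isPurelyInseparable (RatFunc k) L p
  refine ⟨L, inferInstance, inferInstance, inferInstance, inferInstance, ?_⟩
  obtain ⟨c, hc⟩ := surjective_frobenius L p (algebraMap (RatFunc k) L RatFunc.X)
  haveI : IsDomain (L ⊗[RatFunc k] kollarRing k p q) :=
    isDomain_tensor_kollarRing k p q hpq L c (by simpa [frobenius_def] using hc)
  haveI : IsDomain (kollarRing k p q ⊗[RatFunc k] L) :=
    (Algebra.TensorProduct.comm (RatFunc k) (kollarRing k p q) L).toMulEquiv.isDomain _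
  exact IsIntegral.of_isIso (pullbackSpecIso (RatFunc k) (kollarRing k p q) L).inv

omit hq in
/-- `C` is an integral scheme. [folklore] -/
theorem isIntegral [CharP k p] (hpq : ¬ p ∣ q) : IsIntegral (Spec (.of (kollarRing k p q))) :=
  (integralOverPerfectClosure k p q hpq).isIntegral

/-- `C` is a regular scheme (`KollarCurveAnyField.isRegularRing_kollarRing`). [cite: Kollar2007, 1.19 (Curves over nonperfect fields)] -/
theorem isRegular [CharP k p] (hpq : ¬ p ∣ q) : Scheme.IsRegular (Spec (.of (kollarRing k p q))) :=
  haveI := isRegularRing_kollarRing k p q hpq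
  Scheme.isRegular_Spec _

/-- The local rings of `C` have dimension `≤ 1`. [folklore] -/
theorem ringKrullDim_stalk_le_one (x : Spec (.of (kollarRing k p q))) :
    ringKrullDim ((Spec (.of (kollarRing k p q))).presheaf.stalk x) ≤ 1 := by
  rw [ringKrullDim_eq_of_ringEquiv (Spec.stalkIso (.of (kollarRing k p q)) x).commRingCatIsoToRingEquiv,
    IsLocalization.AtPrime.ringKrullDim_eq_height x.asIdeal (Localization.AtPrime x.asIdeal),
    ← ringKrullDim_kollarRing k p q]
  exact Ideal.height_le_ringKrullDim_of_ne_top x.2.ne_top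

/-- `dim C ≤ 1`. [folklore] -/
theorem topologicalKrullDim_le_one :
    topologicalKrullDim (Spec (.of (kollarRing k p q))) ≤ 1 := by
  rw [show topologicalKrullDim (Spec (.of (kollarRing k p q))) = ringKrullDim (kollarRing k p q) from
    PrimeSpectrum.topologicalKrullDim_eq_ringKrullDim (kollarRing k p q), ringKrullDim_kollarRing k p q]

/-- **KOLLÁR'S REGULAR CURVE HAS NO SMOOTH PROPER BIRATIONAL MODEL OVER `k(t)`, FOR EVERY FIELD `k` OF
CHARACTERISTIC `p`** (`p ∤ q`). If
`π : Y ⟶ C` were proper birational with `Y` smooth over `k(t)`, then `Y` is reduced (smooth over a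
field), hence integral, and `π` is an isomorphism (§1: `C` is a regular curve); so `C ⟶ Spec k(t)` would be
smooth, hence so would be its base change `C_K ⟶ Spec K`, `K = k(t)(t^{1/p})`, whose local rings would then all
be regular (Stacks 056S) — but `C_K = Spec K[X,Y]/(Y^q − (X − t^{1/p})^p)` is not regular at `(t^{1/p}, 0)`
(`KollarCurveAnyField.not_isRegularLocalRing_cuspIdeal`, the barrier computation transcribed to `k(t)`). This is
the global form of Kollár 2007, 1.19 for "`k` any field of characteristic `p`"; the `𝔽_p(t)` instance is
`KollarCurve.not_hasSmoothProperBirationalModel`. [cite: Kollar2007, 1.19 (Curves over nonperfect fields)] -/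
theorem not_hasSmoothProperBirationalModel [CharP k p] (hpq : ¬ p ∣ q) :
    ¬ HasSmoothProperBirationalModel (RatFunc k)
      (Spec.map (CommRingCat.ofHom (algebraMap (RatFunc k) (kollarRing k p q)))) := by
  rintro ⟨Y, π, hP, hB, hS⟩
  set f₀ := Spec.map (CommRingCat.ofHom (algebraMap (RatFunc k) (kollarRing k p q))) with hf₀
  haveI := isIntegral k p q hpq
  haveI : IsReduced Y := isReduced_of_smooth (π ≫ f₀)
  haveI : IsIntegral Y := hB.isIntegral
  haveI : IsIso π := isIso_of_isBirational_of_isRegular_of_ringKrullDim_le_one π hB (isRegular k p q hpq)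
    (ringKrullDim_stalk_le_one k p q)
  haveI : Smooth f₀ := by
    have : f₀ = inv π ≫ (π ≫ f₀) := by simp
    rw [this]
    infer_instance
  -- base change to `K = k(t^{1/p})`
  let ι := Spec.map (CommRingCat.ofHom (algebraMap (RatFunc k) (extField k p)))
  have hreg : Scheme.IsRegular (pullback f₀ ι) := fun y =>
    isRegularLocalRing_stalk_of_smooth_of_field (pullback.snd f₀ ι) y
  have hreg' : Scheme.IsRegular (Spec (.of (kollarRing k p q ⊗[RatFunc k] extField k p))) :=
    Scheme.IsRegular.of_iso (pullbackSpecIso (RatFunc k) (kollarRing k p q) (extField k p)).hom hreg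
  let e : kollarRing k p q ⊗[RatFunc k] extField k p ≃+* kollarRingExt k p q :=
    (Algebra.TensorProduct.comm (RatFunc k) (kollarRing k p q) (extField k p)).toRingEquiv.trans
      (kollarRingExtEquiv k p q).toRingEquiv
  haveI : IsNoetherianRing (kollarRing k p q ⊗[RatFunc k] extField k p) :=
    isNoetherianRing_of_ringEquiv (kollarRingExt k p q) (S := kollarRing k p q ⊗[RatFunc k] extField k p) e.symm
  haveI : IsRegularRing (kollarRing k p q ⊗[RatFunc k] extField k p) :=
    (Scheme.isRegular_Spec_iff (CommRingCat.of (kollarRing k p q ⊗[RatFunc k] extField k p))).mp hreg'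
  haveI : IsRegularRing (kollarRingExt k p q) :=
    IsRegularRing.of_ringEquiv (R := kollarRing k p q ⊗[RatFunc k] extField k p) e
  exact not_isRegularLocalRing_cuspIdeal k p q inferInstance

/-- …whereas SOME Frobenius twist of `C` does have a smooth proper birational model (the unconditional rung
`n ≤ 1`: `hasSmoothFrobeniusTwistModel_of_dim_le_one`); with the previous theorem, the exponent is `≥ 1`.
[folklore] -/
theorem hasSmoothFrobeniusTwistModel [CharP k p] (hpq : ¬ p ∣ q) :
    HasSmoothFrobeniusTwistModel p (RatFunc k)
      (Spec.map (CommRingCat.ofHom (algebraMap (RatFunc k) (kollarRing k p q)))) :=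
  haveI := locallyOfFiniteType_f₀ k p q
  hasSmoothFrobeniusTwistModel_of_dim_le_one p (RatFunc k) _ (topologicalKrullDim_le_one k p q)
    (integralOverPerfectClosure k p q hpq)

end KollarCurveAnyField

/-! ## §2 For EVERY field `k` of characteristic `p`: the pinned step fails at grade `1`, and at every grade `n ≥ 1`
it is the negation of its own hypothesis -/

/-- **`¬ SmoothModelStepRegularAt k 1` for EVERY field `k` of characteristic `p`** (door 1: every perfect `M`;
door 2: every algebraically closed `M`; and all other `k`) — THE FROBENIUS EXPONENT IS LOAD-BEARING AT THE FIRST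
GRADE AT EVERY CONSTANT FIELD. The hypothesis of the pinned step (resolution of integral curves over `k(t)`) is a
theorem (`Resolution.hasResolution_of_dim_le_one`); its conclusion fails for Kollár's curve `y^{p+1} = x^p − t`
over `k(t)` (`KollarCurveAnyField.not_hasSmoothProperBirationalModel`). The `𝔽_p` instance is
`not_smoothModelStepRegularAt_zmod_one`. [cite: Kollar2007, 1.19 (Curves over nonperfect fields)] -/
theorem not_smoothModelStepRegularAt_one (p : ℕ) [hp : Fact p.Prime] (k : Type) [Field k] [CharP k p] :
    ¬ SmoothModelStepRegularAt k 1 := by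
  haveI : Fact (1 < p + 1) := ⟨by have := hp.out.one_lt; omega⟩
  intro h
  have hyp : ∀ (X : Scheme.{0}) (f : X ⟶ Spec (.of (RatFunc k))),
      IsSeparated f → LocallyOfFiniteType f → QuasiCompact f → IsIntegral X →
        topologicalKrullDim X ≤ 1 → Scheme.HasResolution X := by
    intro X f _ _ _ _ hd
    exact hasResolution_of_dim_le_one X f hd
  exact KollarCurveAnyField.not_hasSmoothProperBirationalModel k p (p + 1) (not_dvd_succ_self p)
    (h hyp _ _ inferInstance (KollarCurveAnyField.locallyOfFiniteType_f₀ k p (p + 1)) inferInstance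
      (KollarCurveAnyField.topologicalKrullDim_le_one k p (p + 1))
      (KollarCurveAnyField.integralOverPerfectClosure k p (p + 1) (not_dvd_succ_self p))
      (KollarCurveAnyField.isRegular k p (p + 1) (not_dvd_succ_self p)))

/-- **TIGHTNESS OF THE RESIDUAL'S NORMAL FORM AT GRADE 1, AT EVERY CONSTANT FIELD.** For every prime `p` and every
field `k` of characteristic `p`: `FrobeniusTwistStepRegularAt p k 1` holds (`frobeniusTwistStepRegularAt_of_le_one`,
unconditional) while `SmoothModelStepRegularAt k 1` fails. In particular for the door-2 constant fields
(`k` algebraically closed, `CampaignW82.PerfectionStepAlgClosedDimLe` / `…AlgClosureFgDimLe` through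
`residual_normalForms_tfae`) exactly as for door 1. [cite: Kollar2007, 1.19 (Curves over nonperfect fields)] -/
theorem frobeniusTwistStepRegularAt_one_and_not_smoothModelStepRegularAt_one' (p : ℕ) [Fact p.Prime]
    (k : Type) [Field k] [CharP k p] :
    FrobeniusTwistStepRegularAt p k 1 ∧ ¬ SmoothModelStepRegularAt k 1 :=
  ⟨frobeniusTwistStepRegularAt_of_le_one p k le_rfl, not_smoothModelStepRegularAt_one p k⟩

/-- **The conclusion block of the pinned step fails over `k(t)` in every grade `n ≥ 1`**, for every field `k` of
characteristic `p` (the witness is a curve). [cite: Kollar2007, 1.19 (Curves over nonperfect fields)] -/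
theorem not_smoothModelStepRegularAt_conclusion (p : ℕ) [hp : Fact p.Prime] (k : Type) [Field k] [CharP k p]
    {n : WithBot ℕ∞} (hn : 1 ≤ n) :
    ¬ ∀ (X₀ : Scheme.{0}) (f₀ : X₀ ⟶ Spec (.of (RatFunc k))),
      IsSeparated f₀ → LocallyOfFiniteType f₀ → QuasiCompact f₀ → topologicalKrullDim X₀ ≤ n →
        IntegralOverPerfectClosure (RatFunc k) f₀ → Scheme.IsRegular X₀ →
          HasSmoothProperBirationalModel (RatFunc k) f₀ := by
  haveI : Fact (1 < p + 1) := ⟨by have := hp.out.one_lt; omega⟩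
  intro h
  exact KollarCurveAnyField.not_hasSmoothProperBirationalModel k p (p + 1) (not_dvd_succ_self p)
    (h _ _ inferInstance (KollarCurveAnyField.locallyOfFiniteType_f₀ k p (p + 1)) inferInstance
      ((KollarCurveAnyField.topologicalKrullDim_le_one k p (p + 1)).trans hn)
      (KollarCurveAnyField.integralOverPerfectClosure k p (p + 1) (not_dvd_succ_self p))
      (KollarCurveAnyField.isRegular k p (p + 1) (not_dvd_succ_self p)))

/-- **At every constant field `k` of characteristic `p`, in every grade `n ≥ 1`, the pinned step HOLDS IFF ITS
HYPOTHESIS FAILS**: `SmoothModelStepRegularAt k n ↔ ¬ (resolution of integral separated schemes of finite type of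
dimension ≤ n over k(t))`. [folklore] -/
theorem smoothModelStepRegularAt_iff_not_hyp (p : ℕ) [Fact p.Prime] (k : Type) [Field k] [CharP k p]
    {n : WithBot ℕ∞} (hn : 1 ≤ n) :
    SmoothModelStepRegularAt k n ↔
      ¬ ∀ (X : Scheme.{0}) (f : X ⟶ Spec (.of (RatFunc k))),
        IsSeparated f → LocallyOfFiniteType f → QuasiCompact f → IsIntegral X →
          topologicalKrullDim X ≤ n → Scheme.HasResolution X :=
  ⟨fun h hyp => not_smoothModelStepRegularAt_conclusion p k hn (h hyp), fun h hyp => absurd hyp h⟩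

/-- **`¬ SmoothModelStepRegularAt k n` for `1 ≤ n ≤ 3` and every field `k` of characteristic `p`, CONDITIONAL on
FACT-LIST F-02** (`hCP : CossartPiltant2019`). [cite: CossartPiltant2019, Thm. 1.1] -/
theorem not_smoothModelStepRegularAt_of_le_three (hCP : CossartPiltant2019.{0}) (p : ℕ) [Fact p.Prime]
    (k : Type) [Field k] [CharP k p] {n : WithBot ℕ∞} (h1 : 1 ≤ n) (h3 : n ≤ 3) :
    ¬ SmoothModelStepRegularAt k n :=
  fun h => (smoothModelStepRegularAt_iff_not_hyp p k h1).mp h fun X f hs hl hq _ hd =>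
    hCP (RatFunc k) X f hs hl hq inferInstance (hd.trans h3)

/-- **At `n = ⊤`, for every field `k` of characteristic `p`, the exponent-zero «residual» is EQUIVALENT TO THE
FAILURE OF RESOLUTION OVER `k(t)`** — hence refuted by `ResolutionInChar p`
(`not_smoothModelStepRegularAt_top_of_resolutionInChar`): anti-implied by the summit, unlike the four genuine
normal forms. [folklore] -/
theorem smoothModelStepRegularAt_top_iff (p : ℕ) [Fact p.Prime] (k : Type) [Field k] [CharP k p] :
    SmoothModelStepRegularAt k ⊤ ↔
      ¬ ∀ (X : Scheme.{0}) (f : X ⟶ Spec (.of (RatFunc k))),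
        IsSeparated f → LocallyOfFiniteType f → QuasiCompact f → IsIntegral X → Scheme.HasResolution X := by
  rw [smoothModelStepRegularAt_iff_not_hyp p k le_top]
  exact not_congr ⟨fun h X f hs hl hq hi => h X f hs hl hq hi le_top,
    fun h X f hs hl hq hi _ => h X f hs hl hq hi⟩

/-- `ResolutionInChar p` refutes the exponent-zero «residual» at `⊤` over every field `k` of characteristic `p`.
[folklore] -/
theorem not_smoothModelStepRegularAt_top_of_resolutionInChar (p : ℕ) [Fact p.Prime] (k : Type) [Field k]
    [CharP k p] (h : ResolutionInChar.{0} p) : ¬ SmoothModelStepRegularAt k ⊤ :=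
  fun hs => (smoothModelStepRegularAt_top_iff p k).mp hs fun X f hs' hl hq _ =>
    h (RatFunc k) X f hs' hl hq inferInstance

/-- **No field of characteristic `p` satisfies the pinned step at grade `1`** — the sharp form of
`not_forall_smoothModelStepRegularAt_one` (which only denied the universally quantified door-1 shape).
[cite: Kollar2007, 1.19 (Curves over nonperfect fields)] -/
theorem forall_not_smoothModelStepRegularAt_one (p : ℕ) [Fact p.Prime] :
    ∀ (M : Type) [Field M] [CharP M p], ¬ SmoothModelStepRegularAt M 1 :=
  fun M _ _ => not_smoothModelStepRegularAt_one p M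

/-- **Door 2's shape, pinned, is false as well**: it is not the case that `SmoothModelStepRegularAt M 1` holds for
every ALGEBRAICALLY CLOSED field `M` of characteristic `p` (witness `M = (𝔽_p)^{alg}`; door 2's graded residuals
quantify over exactly these constant fields — `CampaignW82.PerfectionStepAlgClosedDimLe`). [cite: Kollar2007, 1.19 (Curves over nonperfect fields)] -/
theorem not_forall_isAlgClosed_smoothModelStepRegularAt_one (p : ℕ) [Fact p.Prime] :
    ¬ ∀ (M : Type) [Field M] [CharP M p] [IsAlgClosed M], SmoothModelStepRegularAt M 1 :=
  fun h => not_smoothModelStepRegularAt_one p (AlgebraicClosure (ZMod p)) (h (AlgebraicClosure (ZMod p)))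

/-- **The pinned form is STRICTLY STRONGER than the residual.** For `M` of characteristic `p`,
`SmoothModelStepRegularAt M n → PerfectionStepAt M n` (pinned ⇒ regular Frobenius-twist form ⇒ Frobenius-twist form
⇒ perfection step, by `frobeniusTwistStepRegularAt_of_smoothModelStepRegularAt`, `frobeniusTwistStepAt_iff_regular`,
`perfectionStepAt_iff_frobeniusTwistStepAt`); at `n = 1` the antecedent is false for every `M`
(`not_smoothModelStepRegularAt_one`) while the consequent is true (`perfectionStepDimLe_of_le_one` territory), so the
implication cannot be reversed. [folklore] -/
theorem perfectionStepAt_of_smoothModelStepRegularAt (p : ℕ) [Fact p.Prime] {M : Type} [Field M] [CharP M p]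
    {n : WithBot ℕ∞} (h : SmoothModelStepRegularAt M n) : PerfectionStepAt M n :=
  (perfectionStepAt_iff_frobeniusTwistStepAt p M n).mpr
    ((frobeniusTwistStepAt_iff_regular p M n).mpr (frobeniusTwistStepRegularAt_of_smoothModelStepRegularAt h))

/-! ## v2 (append-only): the uniqueness lemma with a GLOBAL dimension hypothesis

Everything above this line is byte-identical with v1 (p508560) except the one added `import` of
`Literature.AlgebraicGeometry.Motives.VarietiesDimensionProofs` (for `dim 𝒪_{Y,y} ≤ dim Y`). Appended by
res-L1-s82-pv-1 (gen 3): the convenience form of `isIso_of_isBirational_of_isRegular_of_ringKrullDim_le_one`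
(Theorems/UniversalCellsCampaignW82ExponentZeroProofs.lean §1) with `topologicalKrullDim Y ≤ 1` in place of the
stalkwise bound, for re-use by other curve arguments. -/

/-- **A proper birational morphism of integral schemes onto a locally Noetherian REGULAR scheme of dimension
`≤ 1` is an isomorphism** (uniqueness of the regular model of a curve; `dim 𝒪_{Y,y} ≤ dim Y` by
`Motives.Scheme.topologicalKrullDim_eq_iSup_ringKrullDim_stalk`, then
`isIso_of_isBirational_of_isRegular_of_ringKrullDim_le_one`). [cite: Liu2002, Cor. 4.4.3] -/
theorem isIso_of_isBirational_of_isRegular_of_topologicalKrullDim_le_one {T Y : Scheme.{u}} [IsIntegral T]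
    [IsIntegral Y] [IsLocallyNoetherian Y] (g : T ⟶ Y) [IsProper g] (hg : IsBirational g)
    (hreg : Scheme.IsRegular Y) (hdim : topologicalKrullDim Y ≤ 1) : IsIso g :=
  isIso_of_isBirational_of_isRegular_of_ringKrullDim_le_one g hg hreg fun y =>
    (le_trans (by
      rw [Literature.AlgebraicGeometry.Motives.Scheme.topologicalKrullDim_eq_iSup_ringKrullDim_stalk]
      exact le_iSup (fun x : Y => ringKrullDim (Y.presheaf.stalk x)) y) hdim)

end Summit.ResolutionOfSingularities.ResolutionOfSingularities.Theorems.CampaignW82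

end
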